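import Summits.QuantumFields.YangMills.Theorems.AllWindowsColdBoxBoxHighLineCubeTwoCentreSums
import Summits.QuantumFields.YangMills.Theorems.AllWindowsColdBoxBoxHighLinePlaquetteShellSum

/-!
# Edge-indexed one- and two-centre lattice sums in the cold box (U5 prep, lifts L2/L3): the adapter of ✓`cubeShellSums` /
# ✓`cubeTwoCentreSums` to sums over the Landau free edges `e : LandauFree H` (and the chart coordinates `LandauFree H × Fin 3`)

Width seat `ym-line-sfw-p2-w3` (g41), cell ym-idea-1; helper-grade glue for the connected three- and four-point estimates of U5-BLOCKERS §2 (L2: this seat's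
`…Cum3TriangleBound`; L3: LEAD g78's C4).  The kernel decays of the line (✓S3b `LandauKernelDecay`, ✓H4b.1′ `LandauKernelGradDecay`, ✓U1c
`LandauDipoleDecay`, ✓`GhostFP.abs_ghostM_le`) are indexed by free EDGES through their base sites `e.1.1.1`, in the ℓ¹ or the sup distance; the landed
lattice sums (✓T-S5.8a/8b) run over the SITES of a cube `cubeSites N = {0,…,N}⁴` in the sup distance `siteDist`.  This file bridges the two:

* `siteDist_sub_sub` (translation invariance), `siteDist_le_cast_l1` / `one_div_l1_pow_le` (`d_∞ ≤ ℓ¹`, so `(1+ℓ¹)⁻ᵏ ≤ (1+d_∞)⁻ᵏ`: the ℓ¹-kernels plug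
  into `siteDist` sums), `one_add_log_cube_le` (`1 + log(2H+2) ≤ 4(1 + log H)`);
* `base_sub_dirCorner_mem` — the shifted base site `e.1.1.1 − dirCorner` of a free edge lies in `cubeSites (2H+2)`;
  ★ `sum_edges_le_four_mul_sum_cube` — `Σ_{e : LandauFree H} f(e.1.1.1 − dirCorner) ≤ 4·Σ_{z ∈ cubeSites(2H+2)} f z` for `f ≥ 0`
  (the map `e ↦ (base − dirCorner, direction)` is injective into `cubeSites(2H+2) × Fin 4`);
* ★ `edgeShellSums` — `∃ C ≥ 0, ∀ H ≥ 1, ∀ x, Σ_e (1+d(e,x))⁻² ≤ C·H²`, `Σ_e (1+d(e,x))⁻⁴ ≤ C(1+log H)`, `Σ_e (1+d(e,x))⁻⁵ ≤ C`;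
* ★ `edgeTwoCentreSums` — `∃ C ≥ 0, ∀ H ≥ 1, ∀ x y, Σ_e (1+d(e,x))⁻²(1+d(e,y))⁻² ≤ C(1+log H)`, `Σ_e (1+d(e,x))⁻²(1+d(e,y))⁻⁴ ≤ C(1+log H)/(1+d(x,y))²`,
  `Σ_e (1+d(e,x))⁻⁴(1+d(e,y))⁻⁴ ≤ C(1+log H)/(1+d(x,y))⁴` (`d(e,x) = siteDist e.1.1.1 x`);
* `sum_coord_eq_three_mul` — `Σ_{i : LandauFree H × Fin 3} f(i.1) = 3·Σ_e f e` (chart coordinates carry a colour factor 3).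

Everything proved, no definitions, standard axioms.  HONEST LABEL: counting glue for the RECORDED lifts L2/L3 of the NEXT rung U5 (⟨stmt-QuantumFields-24336⟩,
UNSTAFFED); ⟨24004⟩ ⟨24336⟩ remain OPEN; route AllWindowsColdBox is DRAFT; no crux, rung or summit is proved; **the Yang–Mills mass gap is NOT proved by
this file; no summit is proved by a line.**
-/

set_option autoImplicit false

noncomputable section

open Finset
open Literature.MathematicalPhysics.QuantumFieldTheory
open Literature.MathematicalPhysics.QuantumFieldTheory.LatticeMaxwell
open Literature.MathematicalPhysics.QuantumFieldTheory.AxialGauge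
open Summit.QuantumFields.YangMills.Theorems.WeakCouplingRates
open Literature.Probability.LatticeModels (Site)

namespace Summit.QuantumFields.YangMills.Theorems.AllWindowsColdBoxBoxHighLine

namespace EdgeSums

variable {H : ℕ}

/-! ## Distances -/

/-- Translation invariance of the sup distance. -/
theorem siteDist_sub_sub (x y c : Site 4) : siteDist (x - c) (y - c) = siteDist x y := by
  unfold siteDist
  congr 1
  funext k
  simp only [Pi.sub_apply]
  congr 1
  push_cast
  ring

/-- `d_∞(x,y) ≤ ‖x − y‖₁`. -/
theorem siteDist_le_cast_l1 (x y : Site 4) : siteDist x y ≤ (((∑ m : Fin 4, |x m - y m|) : ℤ) : ℝ) := by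
  refine CubeTwoCentre.siteDist_le_of_forall x y fun k => ?_
  have h : |x k - y k| ≤ ∑ m : Fin 4, |x m - y m| :=
    Finset.single_le_sum (f := fun m => |x m - y m|) (fun m _ => abs_nonneg _) (Finset.mem_univ k)
  have h' : ((|x k - y k| : ℤ) : ℝ) ≤ (((∑ m : Fin 4, |x m - y m|) : ℤ) : ℝ) := by exact_mod_cast h
  simpa [Int.cast_abs, Int.cast_sub] using h'

/-- `(1 + ‖x−y‖₁)⁻ᵏ ≤ (1 + d_∞(x,y))⁻ᵏ`: ℓ¹-decay bounds imply sup-distance decay bounds. -/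
theorem one_div_l1_pow_le (x y : Site 4) (k : ℕ) :
    1 / (1 + (((∑ m : Fin 4, |x m - y m|) : ℤ) : ℝ)) ^ k ≤ 1 / (1 + siteDist x y) ^ k := by
  have h0 := GhostKernel.siteDist_nonneg x y
  have h1 := siteDist_le_cast_l1 x y
  exact one_div_le_one_div_of_le (by positivity) (pow_le_pow_left₀ (by linarith) (by linarith) k)

/-- `C·L/(1+ℓ¹)ᵏ ≤ C·L/(1+d_∞)ᵏ` for `0 ≤ C·L` (the shape of the line's kernel bounds). -/
theorem div_l1_pow_le {A : ℝ} (hA : 0 ≤ A) (x y : Site 4) (k : ℕ) :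
    A / (1 + (((∑ m : Fin 4, |x m - y m|) : ℤ) : ℝ)) ^ k ≤ A / (1 + siteDist x y) ^ k := by
  have h := one_div_l1_pow_le x y k
  have h0 := GhostKernel.siteDist_nonneg x y
  calc A / (1 + (((∑ m : Fin 4, |x m - y m|) : ℤ) : ℝ)) ^ k = A * (1 / (1 + (((∑ m : Fin 4, |x m - y m|) : ℤ) : ℝ)) ^ k) := by ring
    _ ≤ A * (1 / (1 + siteDist x y) ^ k) := mul_le_mul_of_nonneg_left h hA
    _ = A / (1 + siteDist x y) ^ k := by ring

/-- `1 + log(2H+2) ≤ 4·(1 + log H)` for `H ≥ 1`. -/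
theorem one_add_log_cube_le (hH : 1 ≤ H) : 1 + Real.log (((2 * H + 2 : ℕ)) : ℝ) ≤ 4 * (1 + Real.log H) := by
  have hH' : (1 : ℝ) ≤ H := by exact_mod_cast hH
  have hlogH : 0 ≤ Real.log H := Real.log_nonneg hH'
  have h4 : (((2 * H + 2 : ℕ)) : ℝ) ≤ 4 * H := by push_cast; linarith
  have hpos : (0 : ℝ) < ((2 * H + 2 : ℕ) : ℝ) := by positivity
  have hlog : Real.log (((2 * H + 2 : ℕ)) : ℝ) ≤ Real.log 4 + Real.log H := by
    rw [← Real.log_mul (by norm_num) (by positivity)]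
    exact Real.log_le_log hpos h4
  have hlog4 : Real.log 4 ≤ 3 := (Real.log_le_sub_one_of_pos (by norm_num)).trans (by norm_num)
  linarith

/-! ## From free edges to cube sites -/

/-- The shifted base site of a Landau free edge lies in `{0,…,2H+2}⁴`. -/
theorem base_sub_dirCorner_mem (e : LandauFree H) : e.1.1.1 - dirCorner ∈ cubeSites (2 * H + 2) := by
  have hmem := LatticeMaxwell.mem_boxEdgesAt.1 e.1.2
  have hk := (mem_boxEdges_iff.1 hmem).1
  simp only [cubeSites, Fintype.mem_piFinset, Finset.mem_Icc]
  intro k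
  have h := hk k
  constructor
  · exact h.1
  · have h2 := h.2; push_cast at h2 ⊢; omega

/-- ★ **Edge sums are at most four cube sums**: `Σ_{e : LandauFree H} f(e.1.1.1 − dirCorner) ≤ 4·Σ_{z ∈ cubeSites(2H+2)} f z` for `f ≥ 0`. -/
theorem sum_edges_le_four_mul_sum_cube (f : Site 4 → ℝ) (hf : ∀ z, 0 ≤ f z) :
    ∑ e : LandauFree H, f (e.1.1.1 - dirCorner) ≤ 4 * ∑ z ∈ cubeSites (2 * H + 2), f z := by
  classical
  set φ : LandauFree H → Site 4 × Fin 4 := fun e => (e.1.1.1 - dirCorner, e.1.1.2) with hφ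
  have hinj : Function.Injective φ := by
    intro e e' h
    simp only [hφ, Prod.mk.injEq, sub_left_inj] at h
    apply Subtype.ext; apply Subtype.ext
    exact Prod.ext h.1 h.2
  have himg : ∀ e, φ e ∈ cubeSites (2 * H + 2) ×ˢ (Finset.univ : Finset (Fin 4)) := fun e =>
    Finset.mem_product.2 ⟨base_sub_dirCorner_mem e, Finset.mem_univ _⟩
  have h1 : ∑ e : LandauFree H, f (e.1.1.1 - dirCorner) = ∑ z ∈ (Finset.univ : Finset (LandauFree H)).image φ, f z.1 := by
    rw [Finset.sum_image fun e _ e' _ h => hinj h]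
  rw [h1]
  calc ∑ z ∈ (Finset.univ : Finset (LandauFree H)).image φ, f z.1
      ≤ ∑ z ∈ cubeSites (2 * H + 2) ×ˢ (Finset.univ : Finset (Fin 4)), f z.1 :=
        Finset.sum_le_sum_of_subset_of_nonneg (fun z hz => by
          obtain ⟨e, _, rfl⟩ := Finset.mem_image.1 hz; exact himg e) (fun z _ _ => hf z.1)
    _ = 4 * ∑ z ∈ cubeSites (2 * H + 2), f z := by
        rw [Finset.sum_product, Finset.mul_sum]
        refine Finset.sum_congr rfl fun z _ => ?_
        simp only [Finset.sum_const, Finset.card_univ, Fintype.card_fin, nsmul_eq_mul]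
        norm_num

/-- Chart coordinates carry a colour factor `3`: `Σ_{i : LandauFree H × Fin 3} f(i.1) = 3·Σ_e f e`. -/
theorem sum_coord_eq_three_mul (f : LandauFree H → ℝ) : ∑ i : LandauFree H × Fin 3, f i.1 = 3 * ∑ e : LandauFree H, f e := by
  rw [Fintype.sum_prod_type, Finset.mul_sum]
  refine Finset.sum_congr rfl fun e _ => ?_
  simp only [Finset.sum_const, Finset.card_univ, Fintype.card_fin, nsmul_eq_mul]
  norm_num

/-! ## One-centre sums over free edges -/

/-- ★ **Edge shell sums**: `Σ_e (1+d(e,x))⁻² ≤ C·H²`, `Σ_e (1+d(e,x))⁻⁴ ≤ C(1+log H)`, `Σ_e (1+d(e,x))⁻⁵ ≤ C`, uniformly in `x ∈ ℤ⁴`, `H ≥ 1`. -/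
theorem edgeShellSums : ∃ C : ℝ, 0 ≤ C ∧ ∀ H : ℕ, 1 ≤ H → ∀ x : Site 4,
    (∑ e : LandauFree H, 1 / (1 + siteDist e.1.1.1 x) ^ 2 ≤ C * (H : ℝ) ^ 2) ∧
    (∑ e : LandauFree H, 1 / (1 + siteDist e.1.1.1 x) ^ 4 ≤ C * (1 + Real.log H)) ∧
    (∑ e : LandauFree H, 1 / (1 + siteDist e.1.1.1 x) ^ 5 ≤ C) := by
  obtain ⟨C₀, h₀⟩ := cubeShellSums
  have hC₀ : 0 ≤ C₀ := by
    have h := (h₀ 1 le_rfl 0).2.2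
    have hpos : 0 ≤ ∑ p ∈ cubeSites 1, 1 / (1 + siteDist p 0) ^ 5 :=
      Finset.sum_nonneg fun p _ => by have := GhostKernel.siteDist_nonneg p 0; positivity
    linarith
  refine ⟨64 * C₀, by positivity, fun H hH x => ?_⟩
  have hN : 1 ≤ 2 * H + 2 := by omega
  obtain ⟨h2, h4, h5⟩ := h₀ (2 * H + 2) hN (x - dirCorner)
  have hlog := one_add_log_cube_le hH
  have hH' : (1 : ℝ) ≤ H := by exact_mod_cast hH
  have hlogH : 0 ≤ Real.log H := Real.log_nonneg hH'
  have key : ∀ k : ℕ, ∑ e : LandauFree H, 1 / (1 + siteDist e.1.1.1 x) ^ k ≤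
      4 * ∑ z ∈ cubeSites (2 * H + 2), 1 / (1 + siteDist z (x - dirCorner)) ^ k := by
    intro k
    have h := sum_edges_le_four_mul_sum_cube (H := H) (fun z => 1 / (1 + siteDist z (x - dirCorner)) ^ k)
      (fun z => by have := GhostKernel.siteDist_nonneg z (x - dirCorner); positivity)
    refine le_of_eq_of_le (Finset.sum_congr rfl fun e _ => ?_) h
    rw [siteDist_sub_sub]
  refine ⟨?_, ?_, ?_⟩
  · refine (key 2).trans ?_
    have hcast : ((2 * H + 2 : ℕ) : ℝ) ≤ 4 * H := by push_cast; linarith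
    calc 4 * ∑ z ∈ cubeSites (2 * H + 2), 1 / (1 + siteDist z (x - dirCorner)) ^ 2 ≤ 4 * (C₀ * ((2 * H + 2 : ℕ) : ℝ) ^ 2) :=
          mul_le_mul_of_nonneg_left h2 (by norm_num)
      _ ≤ 4 * (C₀ * (4 * H) ^ 2) := by gcongr
      _ = 64 * C₀ * (H : ℝ) ^ 2 := by ring
  · refine (key 4).trans ?_
    calc 4 * ∑ z ∈ cubeSites (2 * H + 2), 1 / (1 + siteDist z (x - dirCorner)) ^ 4
        ≤ 4 * (C₀ * (1 + Real.log (((2 * H + 2 : ℕ)) : ℝ))) := mul_le_mul_of_nonneg_left h4 (by norm_num)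
      _ ≤ 4 * (C₀ * (4 * (1 + Real.log H))) := by gcongr
      _ ≤ 64 * C₀ * (1 + Real.log H) := by nlinarith
  · refine (key 5).trans ?_
    calc 4 * ∑ z ∈ cubeSites (2 * H + 2), 1 / (1 + siteDist z (x - dirCorner)) ^ 5 ≤ 4 * C₀ :=
          mul_le_mul_of_nonneg_left h5 (by norm_num)
      _ ≤ 64 * C₀ := by nlinarith

/-! ## Two-centre sums over free edges -/

/-- ★ **Edge two-centre sums**: uniformly in `x y ∈ ℤ⁴`, `H ≥ 1`,
`Σ_e (1+d(e,x))⁻²(1+d(e,y))⁻² ≤ C(1+log H)`, `Σ_e (1+d(e,x))⁻²(1+d(e,y))⁻⁴ ≤ C(1+log H)/(1+d(x,y))²`, `Σ_e (1+d(e,x))⁻⁴(1+d(e,y))⁻⁴ ≤ C(1+log H)/(1+d(x,y))⁴`. -/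
theorem edgeTwoCentreSums : ∃ C : ℝ, 0 ≤ C ∧ ∀ H : ℕ, 1 ≤ H → ∀ x y : Site 4,
    (∑ e : LandauFree H, 1 / ((1 + siteDist e.1.1.1 x) ^ 2 * (1 + siteDist e.1.1.1 y) ^ 2) ≤ C * (1 + Real.log H)) ∧
    (∑ e : LandauFree H, 1 / ((1 + siteDist e.1.1.1 x) ^ 2 * (1 + siteDist e.1.1.1 y) ^ 4) ≤
      C * (1 + Real.log H) / (1 + siteDist x y) ^ 2) ∧
    (∑ e : LandauFree H, 1 / ((1 + siteDist e.1.1.1 x) ^ 4 * (1 + siteDist e.1.1.1 y) ^ 4) ≤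
      C * (1 + Real.log H) / (1 + siteDist x y) ^ 4) := by
  obtain ⟨C₀, h₀⟩ := cubeTwoCentreSums
  have hC₀ : 0 ≤ C₀ := by
    have h := (h₀ 1 le_rfl 0 0).1
    have hpos : 0 ≤ ∑ p ∈ cubeSites 1, 1 / ((1 + siteDist p 0) ^ 2 * (1 + siteDist p 0) ^ 2) :=
      Finset.sum_nonneg fun p _ => by have := GhostKernel.siteDist_nonneg p 0; positivity
    have h1 : (0 : ℝ) ≤ 1 + Real.log ((1 : ℕ) : ℝ) := by simp
    have : 0 ≤ C₀ * (1 + Real.log ((1 : ℕ) : ℝ)) := hpos.trans h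
    simp at this; exact this
  refine ⟨16 * C₀, by positivity, fun H hH x y => ?_⟩
  have hN : 1 ≤ 2 * H + 2 := by omega
  obtain ⟨h22, h24, h44⟩ := h₀ (2 * H + 2) hN (x - dirCorner) (y - dirCorner)
  rw [siteDist_sub_sub] at h24 h44
  have hlog := one_add_log_cube_le hH
  have hH' : (1 : ℝ) ≤ H := by exact_mod_cast hH
  have hlogH : 0 ≤ Real.log H := Real.log_nonneg hH'
  have hdxy := GhostKernel.siteDist_nonneg x y
  have key : ∀ k l : ℕ, ∑ e : LandauFree H, 1 / ((1 + siteDist e.1.1.1 x) ^ k * (1 + siteDist e.1.1.1 y) ^ l) ≤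
      4 * ∑ z ∈ cubeSites (2 * H + 2), 1 / ((1 + siteDist z (x - dirCorner)) ^ k * (1 + siteDist z (y - dirCorner)) ^ l) := by
    intro k l
    have h := sum_edges_le_four_mul_sum_cube (H := H)
      (fun z => 1 / ((1 + siteDist z (x - dirCorner)) ^ k * (1 + siteDist z (y - dirCorner)) ^ l))
      (fun z => by
        have := GhostKernel.siteDist_nonneg z (x - dirCorner); have := GhostKernel.siteDist_nonneg z (y - dirCorner); positivity)
    refine le_of_eq_of_le (Finset.sum_congr rfl fun e _ => ?_) h
    rw [siteDist_sub_sub, siteDist_sub_sub]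
  have hlog' : C₀ * (1 + Real.log (((2 * H + 2 : ℕ)) : ℝ)) ≤ C₀ * (4 * (1 + Real.log H)) := mul_le_mul_of_nonneg_left hlog hC₀
  refine ⟨?_, ?_, ?_⟩
  · refine (key 2 2).trans ?_
    calc 4 * ∑ z ∈ cubeSites (2 * H + 2), 1 / ((1 + siteDist z (x - dirCorner)) ^ 2 * (1 + siteDist z (y - dirCorner)) ^ 2)
        ≤ 4 * (C₀ * (1 + Real.log (((2 * H + 2 : ℕ)) : ℝ))) := mul_le_mul_of_nonneg_left h22 (by norm_num)
      _ ≤ 4 * (C₀ * (4 * (1 + Real.log H))) := mul_le_mul_of_nonneg_left hlog' (by norm_num)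
      _ = 16 * C₀ * (1 + Real.log H) := by ring
  · refine (key 2 4).trans ?_
    calc 4 * ∑ z ∈ cubeSites (2 * H + 2), 1 / ((1 + siteDist z (x - dirCorner)) ^ 2 * (1 + siteDist z (y - dirCorner)) ^ 4)
        ≤ 4 * (C₀ * (1 + Real.log (((2 * H + 2 : ℕ)) : ℝ)) / (1 + siteDist x y) ^ 2) := mul_le_mul_of_nonneg_left h24 (by norm_num)
      _ ≤ 4 * (C₀ * (4 * (1 + Real.log H)) / (1 + siteDist x y) ^ 2) := by
          refine mul_le_mul_of_nonneg_left (div_le_div_of_nonneg_right hlog' (by positivity)) (by norm_num)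
      _ = 16 * C₀ * (1 + Real.log H) / (1 + siteDist x y) ^ 2 := by ring
  · refine (key 4 4).trans ?_
    calc 4 * ∑ z ∈ cubeSites (2 * H + 2), 1 / ((1 + siteDist z (x - dirCorner)) ^ 4 * (1 + siteDist z (y - dirCorner)) ^ 4)
        ≤ 4 * (C₀ * (1 + Real.log (((2 * H + 2 : ℕ)) : ℝ)) / (1 + siteDist x y) ^ 4) := mul_le_mul_of_nonneg_left h44 (by norm_num)
      _ ≤ 4 * (C₀ * (4 * (1 + Real.log H)) / (1 + siteDist x y) ^ 4) := by
          refine mul_le_mul_of_nonneg_left (div_le_div_of_nonneg_right hlog' (by positivity)) (by norm_num)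
      _ = 16 * C₀ * (1 + Real.log H) / (1 + siteDist x y) ^ 4 := by ring

end EdgeSums

end Summit.QuantumFields.YangMills.Theorems.AllWindowsColdBoxBoxHighLine

end
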